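import Summits.Ventures.LatticeQCDFlow.Scaling.BooleanStarCoupling
import Summits.Ventures.LatticeQCDFlow.Scaling.SectorExactLabelChain

/-!
HONEST FRAMING: exact (Metropolis-corrected) sampling algorithms for lattice gauge theory; figures
of merit are autocorrelation/cost numbers at stated couplings and volumes; no continuum-physics
claim.

# StarSyncCoupling — THE SYNCHRONOUS COUPLING OF THE PERSISTENT HUB ON ANY FINITE CONTENT SPACE `S` WITH ANY ENTRY BIJECTIONS `φ_r` IS A MARKOVIAN
# COUPLING OF `t·GSw + (1−t)·Π_w^M` (chapter P file 1 verbatim with `Bool ↦ S`, `id ↦ φ_r`; lean-2 GEN-31, ours)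

Venture-side (OURS).  Cell `lqcd-flow` (pub-lqcd), unit `pub-lqcd-lean-2-g31`, 2026-08-29.  Chapter R, file 8: the coupling `Q` on which the per-cycle certificate of
`lean-2/MEMO-gen31-coupling-certificate.md` is to be proved (OPEN-MATH-chapterM item 1, `K ≥ 2`), written once for every finite content space `S` and every family of
entry bijections `φ_r` — `BooleanStarCoupling` (chapter P, file 1) is the case `S = Bool`, `φ_r = id`, and the proofs are its proofs letter for letter.  THE COUPLING: the same
entry `r` for both copies; ONE acceptance uniform (both copies move with probability `min{α_r(x), α_r(y)}`, only the likelier one with the excess, neither with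
`1 − max`); the same update level `k`; the hot redraw hands both copies the SAME fresh value; a cold move at an agreeing level is common, at a disagreeing cold level the
copies move independently.  Hypothesis-equations (`hα`, `hQ`); no definitions.

## What is proved

* `starSync_sum_coordKernel_eq_one` (the point-mass form of `P̃_k` is the tree's `coordKernel_eq_sum_ite'`); the rows of `Q`: `starSyncSwap_sum_right` ∕ `_left`, `starSyncUpdate_sum_right` ∕ `_left`
  (the weights' non-negativity is the tree's `syncSwap_weights_nonneg`).
* **`starSync_isMarkovianCoupling`** — `Q` is a Markovian coupling of `t·GSw + (1−t)·Π_w^M` (LPW §5.1, tree `MarkovianCoupling`): `m ≥ 1`, `0 ≤ t ≤ 1`, `w ≥ 0`,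
  `μ > 0`, `M_k` row-stochastic, `M_0(u,·) = μ_0` exact.
* §4 (the hypotheses of `RedrawCycleCoalescence`): `starSync_offDiag_zero_of_eq` (an equal pair never splits), **`starSync_sticky`** (`Q·1{≠} ≤ 1{≠}`),
  `starSync_redraw_isRowStochastic` (the shared redraw kernel `R(a,b) = Σ_v μ_0(v)𝟙{b = (a.1[0↦v], a.2[0↦v])}`), **`starSync_rest`** (`Q = (1−t)w_0·R + M'` with
  `M' ≥ 0` of row sums `1 − (1−t)w_0`).

Reading (no numerics implied): with `RedrawCycleCoalescence` (file 7) this reduces the `K ≥ 2` cold-start law of item 1 to ONE inequality about this explicit `Q` — the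
per-refresh-cycle contraction of `Ψ = (D + ζ·N_bad)·1{D ≥ 1}`; `Q` is sticky (equal pairs move together), so `Q·1{x ≠ y} ≤ 1{x ≠ y}`.  NOT CLAIMED: any contraction.
Literature grade (cell rule): OWN CONSTRUCTION on a textbook notion; nothing cited as a fact; no new bib keys.
-/

noncomputable section

open Finset Function
open Literature.Probability.MarkovChains

namespace Summit.Ventures.LatticeQCDFlow.Scaling

variable {K m : ℕ} {S : Type*} [Fintype S] [DecidableEq S] {μ : Fin (K + 1) → S → ℝ} {M : Fin (K + 1) → S → S → ℝ} {w : Fin (K + 1) → ℝ} {t : ℝ}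

section Coupling
variable (κ : Fin m → Fin K) (φ : Fin m → S ≃ S)

/-- The single-coordinate kernel has unit row sums (`M_k` row-stochastic). [ours] -/
theorem starSync_sum_coordKernel_eq_one (hM : ∀ k, IsRowStochastic (M k)) (k : Fin (K + 1)) (x : Fin (K + 1) → S) :
    ∑ z, coordKernel M k x z = 1 := by
  have h := sum_coordKernel_mul M k x (fun _ => (1 : ℝ))
  simp only [mul_one] at h
  rw [h, (hM k).2]

/-! ## §2 The synchronous coupling: rows -/

/-- **Right marginal of the swap part, entry by entry:** the four outcomes of the common-uniform coupling of the two accept/reject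
decisions sum, over the second coordinate, to `α_r(x)·𝟙{x' = y_r x} + (1 − α_r(x))·𝟙{x' = x}`. [ours] -/
theorem starSyncSwap_sum_right (αx αy : ℝ) (x y yx yy x' : Fin (K + 1) → S) :
    ∑ y' : Fin (K + 1) → S,
        (min αx αy * (if x' = yx ∧ y' = yy then (1 : ℝ) else 0)
          + (αx - min αx αy) * (if x' = yx ∧ y' = y then (1 : ℝ) else 0)
          + (αy - min αx αy) * (if x' = x ∧ y' = yy then (1 : ℝ) else 0)
          + (1 - αx - αy + min αx αy) * (if x' = x ∧ y' = y then (1 : ℝ) else 0))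
      = αx * (if x' = yx then (1 : ℝ) else 0) + (1 - αx) * (if x' = x then (1 : ℝ) else 0) := by
  rw [Finset.sum_add_distrib, Finset.sum_add_distrib, Finset.sum_add_distrib, ← Finset.mul_sum, ← Finset.mul_sum,
    ← Finset.mul_sum, ← Finset.mul_sum, sum_ite_and_right, sum_ite_and_right, sum_ite_and_right, sum_ite_and_right]
  ring

/-- **Left marginal of the swap part, entry by entry.** [ours] -/
theorem starSyncSwap_sum_left (αx αy : ℝ) (x y yx yy y' : Fin (K + 1) → S) :
    ∑ x' : Fin (K + 1) → S,
        (min αx αy * (if x' = yx ∧ y' = yy then (1 : ℝ) else 0)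
          + (αx - min αx αy) * (if x' = yx ∧ y' = y then (1 : ℝ) else 0)
          + (αy - min αx αy) * (if x' = x ∧ y' = yy then (1 : ℝ) else 0)
          + (1 - αx - αy + min αx αy) * (if x' = x ∧ y' = y then (1 : ℝ) else 0))
      = αy * (if y' = yy then (1 : ℝ) else 0) + (1 - αy) * (if y' = y then (1 : ℝ) else 0) := by
  rw [Finset.sum_add_distrib, Finset.sum_add_distrib, Finset.sum_add_distrib, ← Finset.mul_sum, ← Finset.mul_sum,
    ← Finset.mul_sum, ← Finset.mul_sum, sum_ite_and_left, sum_ite_and_left, sum_ite_and_left, sum_ite_and_left]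
  ring

/-- **Right marginal of the update part, level by level:** common move at an agreeing level or at the hot level (exact redraw),
independent moves at a disagreeing cold level — either way the first copy moves by `P̃_k`. [ours] -/
theorem starSyncUpdate_sum_right (hM : ∀ k, IsRowStochastic (M k)) (k : Fin (K + 1)) (x y x' : Fin (K + 1) → S) :
    ∑ y' : Fin (K + 1) → S,
        (if x k = y k ∨ k = 0 then
            ∑ v : S, M k (x k) v * (if x' = update x k v ∧ y' = update y k v then (1 : ℝ) else 0)
          else coordKernel M k x x' * coordKernel M k y y')
      = coordKernel M k x x' := by
  by_cases h : x k = y k ∨ k = 0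
  · simp only [h, if_true]
    rw [Finset.sum_comm]
    simp_rw [← Finset.mul_sum, sum_ite_and_right]
    rw [coordKernel_eq_sum_ite']
  · simp only [h, if_false]
    rw [← Finset.mul_sum, starSync_sum_coordKernel_eq_one hM, mul_one]

/-- **Left marginal of the update part, level by level** (the hot kernel is the exact redraw `M_0(u,·) = μ_0`, so the common hot
move is a move of the second copy too). [ours] -/
theorem starSyncUpdate_sum_left (hM : ∀ k, IsRowStochastic (M k)) (hM0 : ∀ u v, M 0 u v = μ 0 v) (k : Fin (K + 1))
    (x y y' : Fin (K + 1) → S) :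
    ∑ x' : Fin (K + 1) → S,
        (if x k = y k ∨ k = 0 then
            ∑ v : S, M k (x k) v * (if x' = update x k v ∧ y' = update y k v then (1 : ℝ) else 0)
          else coordKernel M k x x' * coordKernel M k y y')
      = coordKernel M k y y' := by
  by_cases h : x k = y k ∨ k = 0
  · simp only [h, if_true]
    rw [Finset.sum_comm]
    simp_rw [← Finset.mul_sum, sum_ite_and_left]
    rw [coordKernel_eq_sum_ite']
    refine sum_congr rfl fun v _ => ?_
    rcases h with h | h
    · rw [h]
    · subst h; rw [hM0, hM0]
  · simp only [h, if_false]
    rw [← Finset.sum_mul, starSync_sum_coordKernel_eq_one hM, one_mul]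

/-! ## §3 The synchronous coupling is a Markovian coupling of the scheme -/

/-- **THE SYNCHRONOUS COUPLING OF THE BOOLEAN STAR IS A MARKOVIAN COUPLING OF `t·GSw + (1−t)·Π_w^M`** (two-point replicas,
identity entry maps on the hub list `κ`, exact hot redraws, arbitrary row-stochastic cold kernels; `m ≥ 1`, `0 ≤ t ≤ 1`, `w ≥ 0`):
common entry, common acceptance uniform (both copies move with probability `min{α_r(x), α_r(y)}`, only the likelier one with the
excess), common hot draw, common cold move at agreeing levels, independent cold moves at disagreeing levels. [ours] -/
theorem starSync_isMarkovianCoupling (hm : 1 ≤ m) (ht0 : 0 ≤ t) (ht1 : t ≤ 1) (hw0 : ∀ k, 0 ≤ w k)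
    (hμ : ∀ k x, 0 < μ k x) (hM : ∀ k, IsRowStochastic (M k)) (hM0 : ∀ u v, M 0 u v = μ 0 v)
    {α : Fin m → (Fin (K + 1) → S) → ℝ}
    (hα : ∀ r z, α r z = min 1 (tensorFun μ (edgeFlowSwap (φ r) 0 (κ r).succ z) / tensorFun μ z))
    {Q : (Fin (K + 1) → S) × (Fin (K + 1) → S) → (Fin (K + 1) → S) × (Fin (K + 1) → S) → ℝ}
    (hQ : ∀ a b, Q a b =
      ∑ r : Fin m, t / m *
        (min (α r a.1) (α r a.2) * (if b.1 = edgeFlowSwap (φ r) 0 (κ r).succ a.1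
              ∧ b.2 = edgeFlowSwap (φ r) 0 (κ r).succ a.2 then (1 : ℝ) else 0)
          + (α r a.1 - min (α r a.1) (α r a.2)) * (if b.1 = edgeFlowSwap (φ r) 0 (κ r).succ a.1 ∧ b.2 = a.2
              then (1 : ℝ) else 0)
          + (α r a.2 - min (α r a.1) (α r a.2)) * (if b.1 = a.1 ∧ b.2 = edgeFlowSwap (φ r) 0 (κ r).succ a.2
              then (1 : ℝ) else 0)
          + (1 - α r a.1 - α r a.2 + min (α r a.1) (α r a.2)) * (if b.1 = a.1 ∧ b.2 = a.2 then (1 : ℝ) else 0))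
      + (1 - t) * ∑ k : Fin (K + 1), w k *
        (if a.1 k = a.2 k ∨ k = 0 then
            ∑ v : S, M k (a.1 k) v * (if b.1 = update a.1 k v ∧ b.2 = update a.2 k v then (1 : ℝ) else 0)
          else coordKernel M k a.1 b.1 * coordKernel M k a.2 b.2)) :
    IsMarkovianCoupling (fun y z : Fin (K + 1) → S =>
        t * ptGraphSwap μ (fun r : Fin m => (((0 : Fin (K + 1)), (κ r).succ) : Fin (K + 1) × Fin (K + 1)))
              φ y z
          + (1 - t) * prodKernel w M y z) Q := by
  have hmpos : (0 : ℝ) < m := Nat.cast_pos.mpr (by omega)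
  have he := hubList_fst_ne_snd (K := K) κ
  have hacc := accept_mem κ φ hμ hα
  -- the scheme, entry by entry, in accept/reject form
  have hP : ∀ y z : Fin (K + 1) → S,
      t * ptGraphSwap μ (fun r : Fin m => (((0 : Fin (K + 1)), (κ r).succ) : Fin (K + 1) × Fin (K + 1)))
            φ y z + (1 - t) * prodKernel w M y z
        = ∑ r : Fin m, t / m * (α r y * (if z = edgeFlowSwap (φ r) 0 (κ r).succ y then (1 : ℝ) else 0)
            + (1 - α r y) * (if z = y then (1 : ℝ) else 0))
          + (1 - t) * ∑ k : Fin (K + 1), w k * coordKernel M k y z := by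
    intro y z
    rw [ptGraphSwap_eq_avg_entryKernel (φ := φ) hm he hμ, prodKernel_apply, Finset.mul_sum]
    congr 1
    refine sum_congr rfl fun r _ => ?_
    rw [entrySwap_eq_accept_reject κ φ hμ hα r y z]
    ring
  intro x y
  refine ⟨fun a b => ?_, fun a => ?_, fun b => ?_⟩
  · -- non-negativity
    show 0 ≤ Q (x, y) (a, b)
    rw [hQ]
    refine add_nonneg (sum_nonneg fun r _ => mul_nonneg (by positivity) ?_)
      (mul_nonneg (by linarith) (sum_nonneg fun k _ => mul_nonneg (hw0 k) ?_))
    · obtain ⟨h1, h2, h3, h4⟩ := syncSwap_weights_nonneg (hacc r x).1 (hacc r x).2 (hacc r y).1 (hacc r y).2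
      refine add_nonneg (add_nonneg (add_nonneg ?_ ?_) ?_) ?_
      · exact mul_nonneg h1 (by split_ifs <;> norm_num)
      · exact mul_nonneg h2 (by split_ifs <;> norm_num)
      · exact mul_nonneg h3 (by split_ifs <;> norm_num)
      · exact mul_nonneg h4 (by split_ifs <;> norm_num)
    · split_ifs
      · exact sum_nonneg fun v _ => mul_nonneg ((hM k).1 _ _) (by split_ifs <;> norm_num)
      · exact mul_nonneg (coordKernel_nonneg M (fun j u v => (hM j).1 u v) k _ _)
          (coordKernel_nonneg M (fun j u v => (hM j).1 u v) k _ _)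
  · -- right marginal: the first copy moves by the scheme
    show ∑ b, Q (x, y) (a, b) = _
    simp_rw [hQ]
    rw [Finset.sum_add_distrib, ← Finset.sum_comm, ← Finset.mul_sum, hP]
    congr 1
    · refine sum_congr rfl fun r _ => ?_
      rw [← Finset.mul_sum, starSyncSwap_sum_right]
    · congr 1
      rw [Finset.sum_comm]
      refine sum_congr rfl fun k _ => ?_
      rw [← Finset.mul_sum, starSyncUpdate_sum_right hM]
  · -- left marginal: the second copy moves by the scheme
    show ∑ a, Q (x, y) (a, b) = _
    simp_rw [hQ]
    rw [Finset.sum_add_distrib, ← Finset.sum_comm, ← Finset.mul_sum, hP]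
    congr 1
    · refine sum_congr rfl fun r _ => ?_
      rw [← Finset.mul_sum, starSyncSwap_sum_left]
    · congr 1
      rw [Finset.sum_comm]
      refine sum_congr rfl fun k _ => ?_
      rw [← Finset.mul_sum, starSyncUpdate_sum_left hM hM0]


/-! ## §4 Stickiness and the redraw decomposition (the hypotheses of `RedrawCycleCoalescence`) -/

/-- **From an equal pair the coupling never creates a disagreement:** `a.1 = a.2`, `b.1 ≠ b.2` ⇒ `Q a b = 0`. [ours] -/
theorem starSync_offDiag_zero_of_eq {α : Fin m → (Fin (K + 1) → S) → ℝ}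
    {Q : (Fin (K + 1) → S) × (Fin (K + 1) → S) → (Fin (K + 1) → S) × (Fin (K + 1) → S) → ℝ}
    (hQ : ∀ a b, Q a b =
      ∑ r : Fin m, t / m *
        (min (α r a.1) (α r a.2) * (if b.1 = edgeFlowSwap (φ r) 0 (κ r).succ a.1
              ∧ b.2 = edgeFlowSwap (φ r) 0 (κ r).succ a.2 then (1 : ℝ) else 0)
          + (α r a.1 - min (α r a.1) (α r a.2)) * (if b.1 = edgeFlowSwap (φ r) 0 (κ r).succ a.1 ∧ b.2 = a.2
              then (1 : ℝ) else 0)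
          + (α r a.2 - min (α r a.1) (α r a.2)) * (if b.1 = a.1 ∧ b.2 = edgeFlowSwap (φ r) 0 (κ r).succ a.2
              then (1 : ℝ) else 0)
          + (1 - α r a.1 - α r a.2 + min (α r a.1) (α r a.2)) * (if b.1 = a.1 ∧ b.2 = a.2 then (1 : ℝ) else 0))
      + (1 - t) * ∑ k : Fin (K + 1), w k *
        (if a.1 k = a.2 k ∨ k = 0 then
            ∑ v : S, M k (a.1 k) v * (if b.1 = update a.1 k v ∧ b.2 = update a.2 k v then (1 : ℝ) else 0)
          else coordKernel M k a.1 b.1 * coordKernel M k a.2 b.2))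
    (a b : (Fin (K + 1) → S) × (Fin (K + 1) → S)) (ha : a.1 = a.2) (hb : b.1 ≠ b.2) : Q a b = 0 := by
  rw [hQ]
  have h1 : ∀ r : Fin m, (if b.1 = edgeFlowSwap (φ r) 0 (κ r).succ a.1 ∧ b.2 = edgeFlowSwap (φ r) 0 (κ r).succ a.2 then (1 : ℝ) else 0) = 0 :=
    fun r => if_neg fun h => hb (by rw [h.1, h.2, ha])
  have h4 : (if b.1 = a.1 ∧ b.2 = a.2 then (1 : ℝ) else 0) = 0 := if_neg fun h => hb (by rw [h.1, h.2, ha])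
  have hα2 : ∀ r : Fin m, α r a.2 = α r a.1 := fun r => by rw [ha]
  have hup : ∀ k : Fin (K + 1), (if a.1 k = a.2 k ∨ k = 0 then
            ∑ v : S, M k (a.1 k) v * (if b.1 = update a.1 k v ∧ b.2 = update a.2 k v then (1 : ℝ) else 0)
          else coordKernel M k a.1 b.1 * coordKernel M k a.2 b.2) = 0 := by
    intro k
    rw [if_pos (Or.inl (by rw [ha]))]
    exact sum_eq_zero fun v _ => by rw [if_neg fun h => hb (by rw [h.1, h.2, ha]), mul_zero]
  simp only [h1, h4, hup, hα2, min_self, sub_self, zero_mul, mul_zero, add_zero, Finset.sum_const_zero]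

/-- **STICKINESS:** with `ind = 1{a.1 ≠ a.2}`, `Q·ind ≤ ind` pointwise, for the synchronous coupling `Q` of a row-stochastic scheme (row sums of `Q` are `1`,
`Q ≥ 0`). [ours] -/
theorem starSync_sticky {Q : (Fin (K + 1) → S) × (Fin (K + 1) → S) → (Fin (K + 1) → S) × (Fin (K + 1) → S) → ℝ}
    (hQs : IsRowStochastic Q) (hzero : ∀ a b : (Fin (K + 1) → S) × (Fin (K + 1) → S), a.1 = a.2 → b.1 ≠ b.2 → Q a b = 0)
    {ind : (Fin (K + 1) → S) × (Fin (K + 1) → S) → ℝ} (hind : ∀ a, ind a = if a.1 = a.2 then 0 else 1)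
    (a : (Fin (K + 1) → S) × (Fin (K + 1) → S)) : ∑ b, Q a b * ind b ≤ ind a := by
  by_cases ha : a.1 = a.2
  · rw [hind a, if_pos ha]
    refine (sum_eq_zero fun b _ => ?_).le
    by_cases hb : b.1 = b.2
    · rw [hind b, if_pos hb, mul_zero]
    · rw [hzero a b ha hb, zero_mul]
  · rw [hind a, if_neg ha]
    calc ∑ b, Q a b * ind b ≤ ∑ b, Q a b := sum_le_sum fun b _ => by
            have h0 := hQs.1 a b
            rw [hind b]; split_ifs <;> nlinarith
      _ = 1 := hQs.2 a

/-- **THE SHARED REDRAW KERNEL** `R(a,b) = Σ_v μ_0(v)·𝟙{b = (a.1[0 ↦ v], a.2[0 ↦ v])}` is non-negative with unit row sums (`μ_0 ≥ 0`, `Σ μ_0 = 1`). [ours] -/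
theorem starSync_redraw_isRowStochastic (hμ0 : ∀ v, 0 ≤ μ 0 v) (hμ1 : ∑ v, μ 0 v = 1)
    {R : (Fin (K + 1) → S) × (Fin (K + 1) → S) → (Fin (K + 1) → S) × (Fin (K + 1) → S) → ℝ}
    (hR : ∀ a b, R a b = ∑ v : S, μ 0 v * (if b.1 = update a.1 0 v ∧ b.2 = update a.2 0 v then (1 : ℝ) else 0)) :
    IsRowStochastic R := by
  refine ⟨fun a b => ?_, fun a => ?_⟩
  · rw [hR]; exact sum_nonneg fun v _ => mul_nonneg (hμ0 v) (by split_ifs <;> norm_num)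
  · simp_rw [hR]
    rw [Finset.sum_comm]
    simp_rw [← Finset.mul_sum]
    have hone : ∀ v : S, ∑ b : (Fin (K + 1) → S) × (Fin (K + 1) → S),
        (if b.1 = update a.1 0 v ∧ b.2 = update a.2 0 v then (1 : ℝ) else 0) = 1 := by
      intro v
      rw [Fintype.sum_prod_type]
      dsimp only
      simp_rw [sum_ite_and_right]
      rw [Finset.sum_ite_eq' univ (update a.1 0 v), if_pos (mem_univ _)]
    simp_rw [hone, mul_one]
    exact hμ1

/-- **THE REST IS NON-NEGATIVE WITH ROW SUMS `1 − (1−t)·w_0`:** `M' = Q − (1−t)w_0·R` (the swap part plus the cold updates) for the synchronous coupling `Q` of a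
row-stochastic scheme with exact hot redraws. [ours] -/
theorem starSync_rest (ht1 : t ≤ 1) (hw0 : ∀ k, 0 ≤ w k) (hμ : ∀ k x, 0 < μ k x) (hμ1 : ∑ v, μ 0 v = 1)
    (hM : ∀ k, IsRowStochastic (M k)) (hM0 : ∀ u v, M 0 u v = μ 0 v) (ht0 : 0 ≤ t)
    {α : Fin m → (Fin (K + 1) → S) → ℝ}
    (hα : ∀ r z, α r z = min 1 (tensorFun μ (edgeFlowSwap (φ r) 0 (κ r).succ z) / tensorFun μ z))
    {Q : (Fin (K + 1) → S) × (Fin (K + 1) → S) → (Fin (K + 1) → S) × (Fin (K + 1) → S) → ℝ}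
    (hQ : ∀ a b, Q a b =
      ∑ r : Fin m, t / m *
        (min (α r a.1) (α r a.2) * (if b.1 = edgeFlowSwap (φ r) 0 (κ r).succ a.1
              ∧ b.2 = edgeFlowSwap (φ r) 0 (κ r).succ a.2 then (1 : ℝ) else 0)
          + (α r a.1 - min (α r a.1) (α r a.2)) * (if b.1 = edgeFlowSwap (φ r) 0 (κ r).succ a.1 ∧ b.2 = a.2
              then (1 : ℝ) else 0)
          + (α r a.2 - min (α r a.1) (α r a.2)) * (if b.1 = a.1 ∧ b.2 = edgeFlowSwap (φ r) 0 (κ r).succ a.2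
              then (1 : ℝ) else 0)
          + (1 - α r a.1 - α r a.2 + min (α r a.1) (α r a.2)) * (if b.1 = a.1 ∧ b.2 = a.2 then (1 : ℝ) else 0))
      + (1 - t) * ∑ k : Fin (K + 1), w k *
        (if a.1 k = a.2 k ∨ k = 0 then
            ∑ v : S, M k (a.1 k) v * (if b.1 = update a.1 k v ∧ b.2 = update a.2 k v then (1 : ℝ) else 0)
          else coordKernel M k a.1 b.1 * coordKernel M k a.2 b.2))
    (hQs : IsRowStochastic Q)
    {R : (Fin (K + 1) → S) × (Fin (K + 1) → S) → (Fin (K + 1) → S) × (Fin (K + 1) → S) → ℝ}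
    (hR : ∀ a b, R a b = ∑ v : S, μ 0 v * (if b.1 = update a.1 0 v ∧ b.2 = update a.2 0 v then (1 : ℝ) else 0))
    {M' : (Fin (K + 1) → S) × (Fin (K + 1) → S) → (Fin (K + 1) → S) × (Fin (K + 1) → S) → ℝ}
    (hM' : ∀ a b, M' a b = Q a b - (1 - t) * w 0 * R a b) :
    (∀ a b, 0 ≤ M' a b) ∧ (∀ a, ∑ b, M' a b = 1 - (1 - t) * w 0) ∧
      (fun a b => Q a b) = ((1 - t) * w 0) • (fun a b => R a b) + fun a b => M' a b := by
  have hacc := accept_mem κ φ hμ hα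
  have hRst := starSync_redraw_isRowStochastic (fun v => (hμ 0 v).le) hμ1 hR
  refine ⟨fun a b => ?_, fun a => ?_, ?_⟩
  · -- `M' = swap part + (1−t)·Σ_{k ≥ 1} w_k·(update part)`: the `k = 0` term of `Q` is exactly `(1−t)w_0·R`
    have hk0 : (if a.1 0 = a.2 0 ∨ (0 : Fin (K + 1)) = 0 then
            ∑ v : S, M 0 (a.1 0) v * (if b.1 = update a.1 0 v ∧ b.2 = update a.2 0 v then (1 : ℝ) else 0)
          else coordKernel M 0 a.1 b.1 * coordKernel M 0 a.2 b.2) = R a b := by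
      rw [if_pos (Or.inr rfl), hR]
      exact sum_congr rfl fun v _ => by rw [hM0]
    rw [hM', hQ, Fin.sum_univ_succ, hk0]
    have hsw : 0 ≤ ∑ r : Fin m, t / m *
        (min (α r a.1) (α r a.2) * (if b.1 = edgeFlowSwap (φ r) 0 (κ r).succ a.1
              ∧ b.2 = edgeFlowSwap (φ r) 0 (κ r).succ a.2 then (1 : ℝ) else 0)
          + (α r a.1 - min (α r a.1) (α r a.2)) * (if b.1 = edgeFlowSwap (φ r) 0 (κ r).succ a.1 ∧ b.2 = a.2
              then (1 : ℝ) else 0)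
          + (α r a.2 - min (α r a.1) (α r a.2)) * (if b.1 = a.1 ∧ b.2 = edgeFlowSwap (φ r) 0 (κ r).succ a.2
              then (1 : ℝ) else 0)
          + (1 - α r a.1 - α r a.2 + min (α r a.1) (α r a.2)) * (if b.1 = a.1 ∧ b.2 = a.2 then (1 : ℝ) else 0)) := by
      refine sum_nonneg fun r _ => mul_nonneg (by positivity) ?_
      obtain ⟨h1, h2, h3, h4⟩ := syncSwap_weights_nonneg (hacc r a.1).1 (hacc r a.1).2 (hacc r a.2).1 (hacc r a.2).2
      refine add_nonneg (add_nonneg (add_nonneg ?_ ?_) ?_) ?_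
      · exact mul_nonneg h1 (by split_ifs <;> norm_num)
      · exact mul_nonneg h2 (by split_ifs <;> norm_num)
      · exact mul_nonneg h3 (by split_ifs <;> norm_num)
      · exact mul_nonneg h4 (by split_ifs <;> norm_num)
    have hcold : 0 ≤ ∑ i : Fin K, w i.succ *
        (if a.1 i.succ = a.2 i.succ ∨ i.succ = 0 then
            ∑ v : S, M i.succ (a.1 i.succ) v * (if b.1 = update a.1 i.succ v ∧ b.2 = update a.2 i.succ v then (1 : ℝ) else 0)
          else coordKernel M i.succ a.1 b.1 * coordKernel M i.succ a.2 b.2) := by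
      refine sum_nonneg fun i _ => mul_nonneg (hw0 _) ?_
      split_ifs
      · exact sum_nonneg fun v _ => mul_nonneg ((hM _).1 _ _) (by split_ifs <;> norm_num)
      · exact mul_nonneg (coordKernel_nonneg M (fun j u v => (hM j).1 u v) _ _ _)
          (coordKernel_nonneg M (fun j u v => (hM j).1 u v) _ _ _)
    nlinarith [mul_nonneg (sub_nonneg.mpr ht1) hcold]
  · have h1 : ∑ b, M' a b = ∑ b, Q a b - (1 - t) * w 0 * ∑ b, R a b := by
      simp_rw [hM']; rw [Finset.sum_sub_distrib, Finset.mul_sum]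
    rw [h1, hQs.2 a, hRst.2 a, mul_one]
  · funext a b; simp only [Pi.add_apply, Pi.smul_apply, smul_eq_mul]; rw [hM']; ring

end Coupling

end Summit.Ventures.LatticeQCDFlow.Scaling

end
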